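import Summits.ABC.StewartYu.PadicG3TwoEndAdapter
import Summits.ABC.StewartYu.GenThreeFramePivotTwo
import HarnessLib

/-!
# Cell abc-stewartyu, Gen-3 frame at `p = 2` (crux `Y07Two`, stmt-ABC-19659), layer F7b: the M2 set-up BUILT FROM
# pivot-last data, and the frame output read back on the data

`Summits/ABC/StewartYu/PadicG3TwoOfData.lean` — cell `abc-stewartyu` (HOME `run/shared/lean/pub/abc-stewartyu/`),
route `PadicPrimesKummerThird`, seat p3 (g5), F-two LEAD.  One definition and theorems.

`GenThreeFramePivotTwo.FrameTwoLast C d` quantifies over data `(α, b)` on `Fin (d+1)` whose last coefficient is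
nonzero of minimal `2`-adic order — exactly the fields of the M2 datum `TwoSetup` (`d` free generators
`α ∘ castSucc`, the eliminated `θ = α (last d)`, `b_θ = b (last d)`, `hbmin`).  `TwoSetup.ofData` is that
constructor; `ofData_all : S.toQ.all = α` and `ofData_ball : S.ball = b` (`Fin.snoc_init_self`) let the frame's
output `PadicG3TwoEndAdapter.frameOutputTwo_of_g3φ` (stated over `S.toQ.all`, `S.ball`, pivot `Fin.last S.d`) be
read as `FrameOutputTwo (d+1) α b (Fin.last d) …` — `frameOutputTwo_ofData`.

WHAT THIS IS NOT: no frame; no crux moves.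

References: K. Yu, Acta Math. 211 (2013), §1 (the normalisation); Yu 1990 §1.1.
-/

noncomputable section

open Finset Polynomial
open Literature.NumberTheory.Transcendental
open Literature.NumberTheory.Transcendental.CW77.Setup (Tau tauNorm)

namespace Summit.ABC.StewartYu

namespace TwoSetup

/-- **The `2`-adic set-up built from pivot-last data**: free generators `α ∘ castSucc`, eliminated generator
`α (last d)`, coefficients likewise. [cite: Yu1990, §1.1 and Theorem 1 (p = 2)] -/
def ofData (d : ℕ) (α : Fin (d + 1) → ℚ) (b : Fin (d + 1) → ℤ)
    (hα : ∀ j, 3 ≤ padicValRat 2 (α j - 1)) (hb : b (Fin.last d) ≠ 0)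
    (hmin : ∀ j, b j ≠ 0 → padicValInt 2 (b (Fin.last d)) ≤ padicValInt 2 (b j)) : TwoSetup where
  d := d
  α := fun j => α (Fin.castSucc j)
  θ := α (Fin.last d)
  b := fun j => b (Fin.castSucc j)
  bθ := b (Fin.last d)
  bθ_ne := hb
  hbmin := fun j hj => hmin (Fin.castSucc j) hj
  hα := fun j => hα (Fin.castSucc j)
  hθ := hα (Fin.last d)

variable {d : ℕ} (α : Fin (d + 1) → ℚ) (b : Fin (d + 1) → ℤ)
  (hα : ∀ j, 3 ≤ padicValRat 2 (α j - 1)) (hb : b (Fin.last d) ≠ 0)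
  (hmin : ∀ j, b j ≠ 0 → padicValInt 2 (b (Fin.last d)) ≤ padicValInt 2 (b j))

/-- The number of free generators is `d`. [folklore] -/
@[simp] theorem ofData_d : (ofData d α b hα hb hmin).d = d := rfl

/-- **All generators of `ofData` are the data**: `toQ.all = α`. [folklore] -/
theorem ofData_all : (ofData d α b hα hb hmin).toQ.all = α := by
  funext j
  unfold SetupQ.all
  refine Fin.lastCases ?_ (fun k => ?_) j
  · simp only [Fin.snoc_last]; rfl
  · simp only [Fin.snoc_castSucc]; rfl

/-- **All coefficients of `ofData` are the data**: `ball = b`. [folklore] -/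
theorem ofData_ball : (ofData d α b hα hb hmin).ball = b := by
  funext j
  unfold ball
  refine Fin.lastCases ?_ (fun k => ?_) j
  · simp only [Fin.snoc_last]; rfl
  · simp only [Fin.snoc_castSucc]; rfl

/-- **The frame output read back on the data.**  If, for the set-up `S = ofData …`, the native identities
`S.g3φ τ x = 0` hold for `|x| ≤ (d+2)X`, `|τ| ≤ (d+2)S₀` (with `Y₀`-factors of degree `≤ D₀`, the signed box
`(Dbox, D_θ)` and a nonzero `κ`-fibre), then `FrameOutputTwo (d+1) α b (Fin.last d) D₀ S₀ X (snoc Dbox D_θ)`.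
[cite: Nesterenko2003, §5.1 (5.1)–(5.4)] -/
theorem frameOutputTwo_ofData {ι : Type*} (R : ι → ℚ[X])
    (u : ι → Fin (ofData d α b hα hb hmin).d → ℤ) (uθ : ι → ℤ) (B : Finset ι) (p : ι → ℤ)
    {D₀ S₀ X : ℕ} {Dbox : Fin (ofData d α b hα hb hmin).d → ℕ} {Dθ : ℕ}
    (hR : ∀ i ∈ B, (R i).natDegree ≤ D₀)
    (hu : ∀ i ∈ B, ∀ j, |u i j| ≤ (Dbox j : ℤ)) (huθ : ∀ i ∈ B, |uθ i| ≤ (Dθ : ℤ))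
    (hne : ∃ κ₀ : Fin ((ofData d α b hα hb hmin).d + 1) → ℤ,
      ∑ i ∈ B.filter (fun i => (ofData d α b hα hb hmin).allκ u uθ i = κ₀), (p i : ℚ) • R i ≠ 0)
    (hzero : ∀ x : ℤ, |x| ≤ ((((ofData d α b hα hb hmin).d + 1 + 1) * X : ℕ) : ℤ) →
      ∀ τ : Tau (ofData d α b hα hb hmin).d, tauNorm τ ≤ ((ofData d α b hα hb hmin).d + 1 + 1) * S₀ →
      (ofData d α b hα hb hmin).g3φ R u uθ B p τ x = 0) :
    GenThreeFrameSpecTwo.FrameOutputTwo (d + 1) α b (Fin.last d) D₀ S₀ X (Fin.snoc Dbox Dθ) := by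
  have h := (ofData d α b hα hb hmin).frameOutputTwo_of_g3φ R u uθ B p hR hu huθ hne hzero
  rw [ofData_all, ofData_ball] at h
  exact h

end TwoSetup

end Summit.ABC.StewartYu

end
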